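import Summits.CriticalPhenomena.CardyFormulaZ2.Theorems.CardyComplexConeEdgePrecompactUFRSJunctionTwoStrandDecayOfFunnel
import Summits.CriticalPhenomena.CardyFormulaZ2.Theorems.CardyComplexConeEdgePrecompactUFRSJunctionFunnel

/-!
# The per-scale junction bound HJ-S and the two-strand junction decay HJ hold
(line `qkz-strip-boundary-arm` of crux `CardyComplexCone.EdgePrecompact`, stmt-CriticalPhenomena-11387;
registered sub-goals `ufrs_junction_scale_le` (HJ-S) and `ufrs_rect_junctionTwoStrandDecay` (HJ),
lead c5, wave 4)

The two one-line consequences of the junction funnel `ufrs_junctionFunnel`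
(`…UFRSJunctionFunnel.lean`): HJ-S by `ufrs_junction_scale_le_of_gate`
(`…UFRSJunctionScaleOfGate.lean`) from S1 `ufrs_junctionGate_prob` (`…UFRSJunctionGateProb.lean`),
S2 `ufrs_junctionFunnel` and S0 `ufrs_junction_deepPair_le` (`…UFRSJunctionDeepPair.lean`); HJ by
`ufrs_rect_junctionTwoStrandDecay_of_funnel` (`…UFRSJunctionTwoStrandDecayOfFunnel.lean`) from S2.

References: H. Kesten, Comm. Math. Phys. 109 (1987), §2; S. Smirnov, C. R. Acad. Sci. Paris 333
(2001), §2.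
-/

set_option linter.unusedVariables false

namespace Summit.CriticalPhenomena.CardyFormulaZ2.Cruxes.EdgePrecompact.QkzStripBoundaryArm

open MeasureTheory Filter Set Metric
open scoped Topology BigOperators Pointwise
open Literature.Probability.LatticeModels Literature.Probability.Percolation
open Literature.Probability.RandomPlanarGeometry (DobrushinDomain)
open Summit.CriticalPhenomena.CardyFormulaZ2.Theses.CardyComplexCone

noncomputable section

/-- **HJ-S: the per-scale junction bound** (registered sub-goal `ufrs_junction_scale_le` of
stmt-CriticalPhenomena-11387): by the assembly `ufrs_junction_scale_le_of_gate` from the gate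
probability S1 `ufrs_junctionGate_prob`, the funnel S2 `ufrs_junctionFunnel` and the deep-pair
bound S0 `ufrs_junction_deepPair_le`. -/
theorem ufrs_junction_scale_le : ∀ (D : DobrushinDomain), (∃ x₀ x₁ y₀ y₁ : ℝ, x₀ < x₁ ∧ y₀ < y₁ ∧ D.carrier = Set.Ioo x₀ x₁ ×ℂ Set.Ioo y₀ y₁) → ∃ (c K M R₀ : ℝ) (N₀ : ℕ), 0 < c ∧ 2 ≤ K ∧ 1 ≤ M ∧ 0 < R₀ ∧ ∃ η₀ > (0:ℝ), ∀ η : ℝ, 0 < η → η < η₀ → ∃ δ₀ > (0:ℝ), ∀ E : DiscreteDobrushin, E.Ω = D.carrier → E.IsZdAdmissible → E.δ < δ₀ → ∀ w : Site 2, ‖meshPoint E.δ w‖ < η → ∀ e₀ : Sym2 (Site 2), (e₀ ∈ E.zdABEdges ∨ e₀ ∈ (shiftData E w).zdABEdges) → ∃ X : Finset ℝ, X.card ≤ N₀ ∧ ∀ r : ℝ, M * η ≤ r → K * r ≤ R₀ → (∀ x ∈ X, r ≤ x / K ∨ K * x ≤ r) → (bondPercolation (zdGraph 2) half).real (ufrsStrands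 E w (medialPoint E.δ e₀) 2 r (K * r)) ≤ 1 - c := ufrs_junction_scale_le_of_gate ufrs_junctionGate_prob ufrs_junctionFunnel ufrs_junction_deepPair_le

/-- **HJ: two corner-disjoint strands at a Dobrushin junction of a rectangle decay polynomially**
(registered sub-goal `ufrs_rect_junctionTwoStrandDecay` of stmt-CriticalPhenomena-11387): by the
assembly `ufrs_rect_junctionTwoStrandDecay_of_funnel` from the funnel S2 `ufrs_junctionFunnel`. -/
theorem ufrs_rect_junctionTwoStrandDecay : ∀ (D : DobrushinDomain), (∃ x₀ x₁ y₀ y₁ : ℝ, x₀ < x₁ ∧ y₀ < y₁ ∧ D.carrier = Set.Ioo x₀ x₁ ×ℂ Set.Ioo y₀ y₁) → ∃ C β : ℝ, 0 < C ∧ 0 < β ∧ ∃ η₀ > (0:ℝ), ∀ η : ℝ, 0 < η → η < η₀ → ∃ δ₀ > (0:ℝ), ∀ E : DiscreteDobrushin, E.Ω = D.carrier → E.IsZdAdmissible → E.δ < δ₀ → ∀ w : Site 2, ‖meshPoint E.δ w‖ < η → ∀ e₀ : Sym2 (Site 2), (e₀ ∈ E.zdABEdges ∨ e₀ ∈ (shiftData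 E w).zdABEdges) → ∀ s S : ℝ, η ≤ s → 0 < S → (bondPercolation (zdGraph 2) half).real (ufrsStrands E w (medialPoint E.δ e₀) 2 s S) ≤ C * (s / S) ^ β := ufrs_rect_junctionTwoStrandDecay_of_funnel ufrs_junctionFunnel

end

end Summit.CriticalPhenomena.CardyFormulaZ2.Cruxes.EdgePrecompact.QkzStripBoundaryArm
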